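import Literature.NumberTheory.EllipticCurves.FunctionFieldEllipticLPolynomialProofs
import Literature.NumberTheory.EllipticCurves.FunctionFieldEllipticLRationalityConstantProofs
import HarnessLib

/-!
# Grothendieck rationality of the formal `L`-series `L(E, T)`: reduction to the analytic leaves

Sibling **proof file** (theorems only, sorry-free; D-0014 / D-0026) of
`Literature.NumberTheory.EllipticCurves.FunctionFieldEllipticLFormal`, written in the provefact pass
on its named fact `isRational_formalL Fq W` (Ulmer 2011, Lecture 1, §9, Exercise 9.2 and
Theorem 9.3: for an elliptic curve `E` over a global function field `F ⊇ 𝔽_q(t)`, the formal Euler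
product `L(E, T) ∈ ℤ[[T]]` of display (9.1) is a rational function `P/Q`, `P, Q ∈ ℤ[T]`, `Q(0) = 1`,
whose poles lie on `|T| = q^{-1/2}` or `|T| = q^{-3/2}`).

## Source

D. Ulmer, *Elliptic curves over function fields*, IAS/Park City Math. Ser. 18 (2011), Lecture 1,
§9 (arXiv:1101.1939, p. 18): Exercise 9.2 (constant `E = E₀ ×_k K`:
`L(E,s) = ∏_{i,j}(1 - αᵢβⱼq^{-s}) / (∏ᵢ(1 - αᵢq^{-s}) ∏ᵢ(1 - αᵢq^{1-s}))`, "its poles lie on the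
lines `Re s = 1/2` and `Re s = 3/2`") and Theorem 9.3 (non-constant `E`: "`L(E,s)` is a polynomial
in `q^{-s}`", Grothendieck–Deligne, proof sketched in Lecture 4, §1.3 by the Grothendieck–Lefschetz
trace formula for `j_* V_ℓ(E)` on `𝒞`).

## Verdict of the provefact pass and what is proved here

`isRational_formalL` is **not discharged**: its non-constant half *is* the first clause of
Theorem 9.3, i.e. Grothendieck's cohomological formula `L(E, T) = det(1 - T·Fr_q | H¹(𝒞̄, j_*𝓕))`
(`H⁰ = H² = 0` for non-constant `E`), and neither étale cohomology nor `ℓ`-adic representations of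
`Gal(F^sep/F)` exist in Mathlib (v4.32.0) or Literature (SIZE XL). What this file proves is that
the formal fact carries **no debt of its own**: it follows from the analytic leaves already
vendored in `FunctionFieldEllipticLRationality`, by the dichotomy constant / non-constant at the
exact constant field `k ⊇ 𝔽_q` of `F` (`#k = q^m`):

* `exists_coe_mul_formalL_eq_of_ellLFunction_eq` — **analytic ⟹ formal.** If
  `Q(q^{-s}) · L(E, s) = Π(q^{-s})` on `Re s > 3/2` for an integer polynomial `Q` and a complex
  polynomial `Π` with `Q(0) = Π(0) = 1`, then `Q · L(E, T) = P` in `ℤ[[T]]` for an integer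
  polynomial `P` (with `P = Π` over `ℂ`). Proof: `L(E, s) = ∑ₙ [Tⁿ]L(E,T) q^{-ns}`
  (`hasSum_coeff_formalL`, `ellLFunction_eq_inv_analyticLInv` of
  `FunctionFieldEllipticLFormalProofs`), every `T` with `0 < |T| < q^{-2}` is a `q^{-s}`, the
  Cauchy product with `Q`, and uniqueness of power-series coefficients on the disc
  (`HasFPowerSeriesAt.eq_formalMultilinearSeries`).
* `formalL_eq_polynomial_of_not_isConstantCurve` — **non-constant `E`**: Theorem 9.3 at `k`
  (`ellLFunction_eq_prod_of_not_isConstantCurve k W`, hypothesis) gives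
  `L(E, s) = ∏ᵢ (1 - αᵢ (q^{-s})^m)`, hence `L(E, T) = P ∈ ℤ[T]`, `P(0) = 1` (`Q = 1`).
* `exists_coe_mul_formalL_eq_of_smul_eq_map` — **constant `E ≅ E₀ ×_k F`**: Exercise 9.2
  (discharged in the tree, `ellLFunction_eq_div_of_isConstantCurve_holds`) with the Frobenius roots
  `α, α'` of `E₀/k` (Hasse–Weil, discharged: `WeierstrassCurve.card_point_baseChange_eq_holds`) and
  the inverse roots `βⱼ` of `ζ_F` (Weil's theorem for `F/k`, hypothesis `IsGenus k F g`) gives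
  `Q · L(E, T) = P` with `Q = Q₀(T^m)`, `Q₀ = (1 - aT + q'T²)(1 - q'aT + q'³T²) ∈ ℤ[T]`
  (`a = α + α' = q' + 1 - #E₀(k)`, `q' = q^m`), whose complex roots `z` have `z^m ∈ {1/αᵢ, 1/(q'αᵢ)}`,
  so `|z| = q^{-1/2}` or `q^{-3/2}` (`|αᵢ| = √q'`).
* `isRational_formalL_of_isFullConstantField_of_facts`, `isRational_formalL_of_facts₂`,
  `isRational_formalL_of_leaves`, `isRational_formalL_of_zeta_leaves`,
  `isRational_formalL_of_schmidt_leaves` — **the assembled reductions**, exactly parallel to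
  `FunctionFieldEllipticLContinuationLeavesProofs` / `FunctionFieldEllipticLPolynomialProofs`:
  `isRational_formalL Fq W` for every constant field `𝔽_q` of `F`, granted over the finite constant
  fields `k` of `F` Weil's theorem (`existsUnique_isGenus(_of_functionField) k F`, or Stichtenoth
  Thm. 5.1.15 (a) + Thm. 5.2.1, or F. K. Schmidt's `∂ = 1` + Thm. 5.2.1) and Ulmer's Theorem 9.3
  (`ellLFunction_eq_prod_of_not_isConstantCurve k W`).

So in the debt graph `isRational_formalL` sits *below* the leaf `h93` (Theorem 9.3, étale
cohomology) and the zeta leaves of `F`, and above the analytic facts it implies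
(`FunctionFieldEllipticLFormalProofs`: `isRational_lFunction_of_functionField`,
`hasLContinuation_of_functionField`). No definition, no new named fact (D-0026); nothing of
`FunctionFieldEllipticLFormal` is restated or weakened.

## References

* [Ulmer2011ParkCity] D. Ulmer, *Elliptic curves over function fields*, IAS/Park City Math. Ser.
  18 (2011), Lecture 1, §9, (9.1), Exercise 9.2, Theorem 9.3; Lecture 4, §1.3 (arXiv:1101.1939,
  pp. 18, 48–50).
* [SilvermanAEC2009] J. H. Silverman, *The Arithmetic of Elliptic Curves*, 2nd ed., Thm. V.2.3.1.
* [Stichtenoth2009] H. Stichtenoth, *Algebraic Function Fields and Codes*, 2nd ed., GTM 254,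
  Cor. 5.1.11, Thm. 5.1.15 (a), Thm. 5.2.1.
* [Weil1948] A. Weil, *Sur les courbes algébriques et les variétés qui s'en déduisent*, 1948.
-/

noncomputable section

open scoped Classical Polynomial

open Complex Filter Topology Polynomial Metric

namespace Literature.NumberTheory.EllipticCurves.FunctionField

/-! ## Elementary lemmas (no function field) -/

section Elementary

/-- A complex polynomial as the sum of its (finitely supported) power series: `∑ₙ pₙ Tⁿ = p(T)`.
[folklore] -/
theorem hasSum_coeff_mul_pow_eval (p : ℂ[X]) (T : ℂ) :
    HasSum (fun n : ℕ => p.coeff n * T ^ n) (p.eval T) := by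
  have h : HasSum (fun n : ℕ => p.coeff n * T ^ n)
      (∑ n ∈ Finset.range (p.natDegree + 1), p.coeff n * T ^ n) :=
    hasSum_sum_of_ne_finset_zero (fun n hn => by
      rw [Finset.mem_range, not_lt] at hn
      rw [coeff_eq_zero_of_natDegree_lt (Nat.lt_of_succ_le hn), zero_mul])
  convert h using 1
  exact eval_eq_sum_range T

/-- **Uniqueness of power-series coefficients on a disc**: two scalar series `∑ cₙ zⁿ`, `∑ dₙ zⁿ`
summing to the same function on a ball around `0` have the same coefficients (one-dimensional
`HasFPowerSeriesAt.eq_formalMultilinearSeries` for `FormalMultilinearSeries.ofScalars`).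
[folklore] -/
theorem eq_of_forall_hasSum {c d : ℕ → ℂ} {g : ℂ → ℂ} {r : ℝ} (hr : 0 < r)
    (hc : ∀ z : ℂ, ‖z‖ < r → HasSum (fun n => c n * z ^ n) (g z))
    (hd : ∀ z : ℂ, ‖z‖ < r → HasSum (fun n => d n * z ^ n) (g z)) : c = d := by
  have key : ∀ e : ℕ → ℂ, (∀ z : ℂ, ‖z‖ < r → HasSum (fun n => e n * z ^ n) (g z)) →
      HasFPowerSeriesAt g (FormalMultilinearSeries.ofScalars ℂ e) 0 := by
    intro e he
    refine hasFPowerSeriesAt_iff.mpr ?_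
    filter_upwards [ball_mem_nhds (0 : ℂ) hr] with z hz
    rw [zero_add]
    simpa only [FormalMultilinearSeries.coeff_ofScalars, smul_eq_mul, mul_comm] using
      he z (mem_ball_zero_iff.mp hz)
  exact FormalMultilinearSeries.ofScalars_series_injective ℂ ℂ
    ((key c hc).eq_formalMultilinearSeries (key d hd))

/-- **Cauchy product with a polynomial.** If `∑ₙ Aₙ Tⁿ = a` absolutely, then for `P ∈ ℤ[T]` the
coefficients of the power series `P · A ∈ ℤ[[T]]` sum to `P(T) · a`
(`tsum_mul_tsum_eq_tsum_sum_antidiagonal_of_summable_norm`, `PowerSeries.coeff_mul`). [folklore] -/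
theorem hasSum_coeff_coe_mul {P : ℤ[X]} {A : PowerSeries ℤ} {T a : ℂ}
    (hA : HasSum (fun n : ℕ => ((PowerSeries.coeff n A : ℤ) : ℂ) * T ^ n) a)
    (hAs : Summable fun n : ℕ => ‖((PowerSeries.coeff n A : ℤ) : ℂ) * T ^ n‖) :
    HasSum (fun n : ℕ => ((PowerSeries.coeff n ((P : PowerSeries ℤ) * A) : ℤ) : ℂ) * T ^ n)
      (aeval T P * a) := by
  have hP : HasSum (fun n : ℕ => ((P.coeff n : ℤ) : ℂ) * T ^ n) (aeval T P) :=
    hasSum_coeff_mul_pow_aeval P T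
  have hPs := summable_norm_coeff_mul_pow_polynomial P T
  have hsum : Summable fun n =>
      ∑ kl ∈ Finset.HasAntidiagonal.antidiagonal n,
        ((P.coeff kl.1 : ℤ) : ℂ) * T ^ kl.1 * (((PowerSeries.coeff kl.2 A : ℤ) : ℂ) * T ^ kl.2) :=
    (summable_norm_sum_mul_antidiagonal_of_summable_norm hPs hAs).of_norm
  have key := tsum_mul_tsum_eq_tsum_sum_antidiagonal_of_summable_norm hPs hAs
  rw [hP.tsum_eq, hA.tsum_eq] at key
  have h3 := hsum.hasSum
  rw [← key] at h3
  convert h3 using 1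
  funext n
  rw [PowerSeries.coeff_mul]
  push_cast
  rw [Finset.sum_mul]
  refine Finset.sum_congr rfl fun kl hkl => ?_
  rw [Finset.HasAntidiagonal.mem_antidiagonal] at hkl
  rw [← hkl, pow_add]; ring

/-- If `1 - γx = 0` then `|x| = |γ|⁻¹`. [folklore] -/
theorem norm_eq_inv_norm_of_one_sub_mul_eq_zero {γ x : ℂ} (h : 1 - γ * x = 0) : ‖x‖ = ‖γ‖⁻¹ := by
  have h1 : γ * x = 1 := (sub_eq_zero.mp h).symm
  have hγ : γ ≠ 0 := by rintro rfl; simp at h1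
  have h2 : ‖γ‖ * ‖x‖ = 1 := by rw [← norm_mul, h1, norm_one]
  field_simp [norm_ne_zero_iff.mpr hγ]
  linarith [h2, mul_comm ‖γ‖ ‖x‖]

/-- `1 - γx ≠ 0` as soon as `|γ| · |x| < 1`. [folklore] -/
theorem one_sub_mul_ne_zero_of_norm_mul_lt_one {γ x : ℂ} (h : ‖γ‖ * ‖x‖ < 1) : 1 - γ * x ≠ 0 := by
  intro h0
  have h1 : γ * x = 1 := (sub_eq_zero.mp h0).symm
  have : ‖γ‖ * ‖x‖ = 1 := by rw [← norm_mul, h1, norm_one]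
  linarith

/-- **`m`-th roots of the two circles.** If `|z|^m = (q^m)^t` (`q > 0`, `m ≥ 1`) then
`|z| = q^t`. [folklore] -/
theorem norm_eq_rpow_of_norm_pow_eq {z : ℂ} {m : ℕ} (hm : m ≠ 0) {q : ℝ} (hq : 0 ≤ q) {t : ℝ}
    (h : ‖z‖ ^ m = ((q ^ m : ℝ)) ^ t) : ‖z‖ = q ^ t := by
  rw [← Real.rpow_pow_comm hq] at h
  exact (pow_left_inj₀ (norm_nonneg z) (Real.rpow_nonneg hq t) hm).mp h

/-- **The poles of Exercise 9.2 lie on `Re s = 1/2` and `Re s = 3/2`.** With `α + α' = a`,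
`αα' = q`, `|α| = |α'| = √q` (Hasse–Weil for `E₀/𝔽_q`), every complex zero `w` of the denominator
`Q₀ = (1 - aT + qT²)(1 - qaT + q³T²) = (1 - αT)(1 - α'T)(1 - α(qT))(1 - α'(qT))` satisfies
`|w| = q^{-1/2}` (if `αw = 1` or `α'w = 1`) or `|w| = q^{-3/2}` (if `αqw = 1` or `α'qw = 1`).
Ulmer (2011), Lecture 1, Exercise 9.2 ("Its poles lie on the lines `Re s = 1/2` and
`Re s = 3/2`"). [cite: Ulmer2011ParkCity, Lect. 1, §9, Exercise 9.2] -/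
theorem norm_eq_rpow_of_aeval_denominator_eq_zero {α α' : ℂ} {a : ℤ} {q : ℕ} (hq : 0 < q)
    (hsum : α + α' = a) (hprod : α * α' = q) (hα : ‖α‖ = √(q : ℝ)) (hα' : ‖α'‖ = √(q : ℝ))
    {w : ℂ}
    (hw : aeval w ((1 - C a * X + C (q : ℤ) * X ^ 2) *
      (1 - C ((q : ℤ) * a) * X + C ((q : ℤ) ^ 3) * X ^ 2)) = 0) :
    ‖w‖ = (q : ℝ) ^ (-(1 / 2 : ℝ)) ∨ ‖w‖ = (q : ℝ) ^ (-(3 / 2 : ℝ)) := by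
  rw [aeval_denominator_eq hsum hprod] at hw
  have hq0 : (0 : ℝ) < q := by exact_mod_cast hq
  have hq0' : (q : ℝ) ≠ 0 := hq0.ne'
  have hsq : (√(q : ℝ))⁻¹ = (q : ℝ) ^ (-(1 / 2 : ℝ)) := by
    rw [Real.sqrt_eq_rpow, ← Real.rpow_neg hq0.le]
  have hnq : ‖((q : ℂ) * w)‖ = (q : ℝ) * ‖w‖ := by rw [norm_mul, Complex.norm_natCast]
  have h32 : (q : ℝ) ^ (-(1 / 2 : ℝ)) / q = (q : ℝ) ^ (-(3 / 2 : ℝ)) := by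
    rw [← Real.rpow_sub_one hq0']; norm_num
  rcases mul_eq_zero.mp hw with h | h
  · left
    rcases mul_eq_zero.mp h with h | h
    · rw [norm_eq_inv_norm_of_one_sub_mul_eq_zero h, hα, hsq]
    · rw [norm_eq_inv_norm_of_one_sub_mul_eq_zero h, hα', hsq]
  · right
    rcases mul_eq_zero.mp h with h | h
    · have h1 := norm_eq_inv_norm_of_one_sub_mul_eq_zero h
      rw [hnq, hα, hsq] at h1
      rw [← h32, ← h1]; field_simp
    · have h1 := norm_eq_inv_norm_of_one_sub_mul_eq_zero h
      rw [hnq, hα', hsq] at h1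
      rw [← h32, ← h1]; field_simp

/-- The constant coefficient of the denominator `Q₀ = (1 - aT + qT²)(1 - qaT + q³T²)` is `1`.
[folklore] -/
theorem coeff_zero_denominator (a : ℤ) (q : ℕ) :
    ((1 - C a * X + C (q : ℤ) * X ^ 2) * (1 - C ((q : ℤ) * a) * X + C ((q : ℤ) ^ 3) * X ^ 2) :
      ℤ[X]).coeff 0 = 1 := by
  simp [mul_coeff_zero]

variable (Fq : Type) [Field Fq] [Fintype Fq]

/-- Every non-zero complex number is `q^{-s}` for some `s ∈ ℂ` (`q = #Fq ≥ 2`; `s = -log T / log q`).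
[folklore] -/
theorem exists_card_cpow_neg_eq {T : ℂ} (hT : T ≠ 0) :
    ∃ s : ℂ, (Fintype.card Fq : ℂ) ^ (-s) = T := by
  have hq : (Fintype.card Fq : ℂ) ≠ 0 := Nat.cast_ne_zero.mpr Fintype.card_ne_zero
  have hlog : Complex.log (Fintype.card Fq : ℂ) ≠ 0 := by
    rw [← Complex.natCast_log]
    exact Complex.ofReal_ne_zero.mpr (Real.log_pos (by exact_mod_cast Fintype.one_lt_card)).ne'
  refine ⟨-(Complex.log T / Complex.log (Fintype.card Fq : ℂ)), ?_⟩
  rw [neg_neg, Complex.cpow_def_of_ne_zero hq,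
    show Complex.log (Fintype.card Fq : ℂ) * (Complex.log T / Complex.log (Fintype.card Fq : ℂ)) =
      Complex.log T by field_simp]
  exact Complex.exp_log hT

/-- If `q^{-s} = T` with `|T| < q^{-σ}` then `σ < Re s`. [folklore] -/
theorem lt_re_of_card_cpow_neg_eq {T : ℂ} {s : ℂ} (hs : (Fintype.card Fq : ℂ) ^ (-s) = T) {σ : ℝ}
    (hT : ‖T‖ < (Fintype.card Fq : ℝ) ^ (-σ)) : σ < s.re := by
  have hq1 : (1 : ℝ) < Fintype.card Fq := by exact_mod_cast Fintype.one_lt_card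
  rw [← hs, norm_card_cpow_neg Fq s, Real.rpow_lt_rpow_left_iff hq1] at hT
  linarith

/-- `1 - γ q^{-s} ≠ 0` and `1 - γ (q · q^{-s}) ≠ 0` for `|γ| = √q` and `Re s > 3/2`
(`|γ q^{-s}| = q^{1/2 - Re s} < 1`, `|γ q^{1-s}| = q^{3/2 - Re s} < 1`): the denominator of
Exercise 9.2 does not vanish on the half-plane of absolute convergence. [folklore] -/
theorem one_sub_mul_card_cpow_ne_zero {γ : ℂ} (hγ : ‖γ‖ = √(Fintype.card Fq : ℝ)) {s : ℂ}
    (hs : (3 / 2 : ℝ) < s.re) :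
    1 - γ * (Fintype.card Fq : ℂ) ^ (-s) ≠ 0 ∧
      1 - γ * ((Fintype.card Fq : ℂ) * (Fintype.card Fq : ℂ) ^ (-s)) ≠ 0 := by
  have hq1 : (1 : ℝ) < Fintype.card Fq := by exact_mod_cast Fintype.one_lt_card
  have hq0 : (0 : ℝ) < Fintype.card Fq := zero_lt_one.trans hq1
  have hn : ‖(Fintype.card Fq : ℂ) ^ (-s)‖ = (Fintype.card Fq : ℝ) ^ (-s.re) := norm_card_cpow_neg Fq s
  have hsqrt : √(Fintype.card Fq : ℝ) = (Fintype.card Fq : ℝ) ^ (1 / 2 : ℝ) := Real.sqrt_eq_rpow _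
  constructor
  · apply one_sub_mul_ne_zero_of_norm_mul_lt_one
    rw [hγ, hn, hsqrt, ← Real.rpow_add hq0]
    exact Real.rpow_lt_one_of_one_lt_of_neg hq1 (by linarith)
  · apply one_sub_mul_ne_zero_of_norm_mul_lt_one
    rw [hγ, norm_mul, hn, Complex.norm_natCast, hsqrt]
    have e : (Fintype.card Fq : ℝ) ^ (1 / 2 : ℝ) *
        ((Fintype.card Fq : ℝ) * (Fintype.card Fq : ℝ) ^ (-s.re)) =
      (Fintype.card Fq : ℝ) ^ ((1 / 2 : ℝ) + 1 + -s.re) := by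
      rw [Real.rpow_add hq0, Real.rpow_add hq0, Real.rpow_one]; ring
    rw [e]
    exact Real.rpow_lt_one_of_one_lt_of_neg hq1 (by linarith)

/-- `n^{1-s} = n · n^{-s}` for a natural number `n ≥ 1`. [folklore] -/
theorem natCast_cpow_one_sub {n : ℕ} (hn : n ≠ 0) (s : ℂ) :
    (n : ℂ) ^ (1 - s) = (n : ℂ) * (n : ℂ) ^ (-s) := by
  rw [sub_eq_add_neg, Complex.cpow_add _ _ (Nat.cast_ne_zero.mpr hn), Complex.cpow_one]

end Elementary

/-! ## Analytic ⟹ formal -/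

section FunctionField

variable (Fq : Type) [Field Fq] [Fintype Fq] {F : Type} [Field F] [Algebra Fq[X] F]
  [Algebra (RatFunc Fq) F] [IsScalarTower Fq[X] (RatFunc Fq) F] [FunctionField Fq F]
  (W : WeierstrassCurve F)

/-- Absolute convergence of `∑ₙ [Tⁿ]L(E,T) · Tⁿ` on the disc `|T| < q^{-σ₀}`, `σ₀ > 3/2` (compare with
a slightly larger real radius, `summable_norm_mul_pow_of_summable`). [folklore] -/
theorem summable_norm_coeff_formalL_mul_pow {σ₀ : ℝ} (hσ₀ : 3 / 2 < σ₀) {T : ℂ}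
    (hT : ‖T‖ < (Fintype.card Fq : ℝ) ^ (-σ₀)) :
    Summable fun n : ℕ => ‖((PowerSeries.coeff n (formalL Fq W) : ℤ) : ℂ) * T ^ n‖ := by
  obtain ⟨ρ, hρ1, hρ2⟩ := exists_between hT
  have hρ0 : 0 ≤ ρ := (norm_nonneg _).trans hρ1.le
  have hρn : ‖(ρ : ℂ)‖ = ρ := by rw [Complex.norm_real, Real.norm_of_nonneg hρ0]
  exact summable_norm_mul_pow_of_summable hρ0
    (hasSum_coeff_formalL Fq W hσ₀ (T := (ρ : ℂ)) (by rwa [hρn])).summable hρ1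

/-- **Analytic ⟹ formal rationality.** Let `Q ∈ ℤ[T]` and `Π ∈ ℂ[T]` with `Q(0) = Π(0) = 1`, and
suppose `Q(q^{-s}) · L(E, s) = Π(q^{-s})` for all `Re s > 3/2`, where `L(E, s) = ellLFunction W s`
is the Euler product. Then there is `P ∈ ℤ[T]`, equal to `Π` over `ℂ`, with `Q · L(E, T) = P` in
`ℤ[[T]]` for the formal `L`-series `L(E, T) = formalL Fq W` of (9.1). Proof: by
"`L(E, s) = L(E, q^{-s})`" (`hasSum_coeff_formalL`, `ellLFunction_eq_inv_analyticLInv` of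
`FunctionFieldEllipticLFormalProofs`) and the Cauchy product, the coefficients of `Q · L(E, T)`
sum to `Π(T)` at every `T = q^{-s}`, `|T| < q^{-2}` — i.e. at every `T ≠ 0` of that disc — and
at `T = 0`; by uniqueness of power-series coefficients they are the coefficients of `Π`, hence
vanish beyond `deg Π`. This is the passage, left implicit in the source ("`T` is a formal
indeterminant and `s` is a complex number"), from the printed statements about `L(E, s)` to the
formal series. [cite: Ulmer2011ParkCity, Lect. 1, §9, (9.1) and "`L(E,s) = L(E,q^{-s})`"] -/
theorem exists_coe_mul_formalL_eq_of_ellLFunction_eq {Q : ℤ[X]} {Pc : ℂ[X]} (hQ0 : Q.coeff 0 = 1)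
    (hP0 : Pc.coeff 0 = 1)
    (h : ∀ s : ℂ, (3 / 2 : ℝ) < s.re →
      aeval ((Fintype.card Fq : ℂ) ^ (-s)) Q * ellLFunction W s =
        Pc.eval ((Fintype.card Fq : ℂ) ^ (-s))) :
    ∃ P : ℤ[X], P.map (Int.castRingHom ℂ) = Pc ∧ (Q : PowerSeries ℤ) * formalL Fq W = P := by
  have hq0 : (0 : ℝ) < Fintype.card Fq := by exact_mod_cast Fintype.card_pos
  set r : ℝ := (Fintype.card Fq : ℝ) ^ (-(2 : ℝ)) with hr
  have hr0 : 0 < r := Real.rpow_pos_of_pos hq0 _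
  set R : PowerSeries ℤ := (Q : PowerSeries ℤ) * formalL Fq W with hR
  have hL0 : PowerSeries.coeff 0 (formalL Fq W) = 1 := by
    rw [PowerSeries.coeff_zero_eq_constantCoeff_apply, constantCoeff_formalL]
  have hR0 : PowerSeries.coeff 0 R = 1 := by
    rw [hR, PowerSeries.coeff_mul, Finset.Nat.antidiagonal_zero, Finset.sum_singleton]
    simp [Polynomial.coeff_coe, hQ0, hL0]
  -- the coefficients of `R` sum to `Pc.eval T` on the ball of radius `r`
  have hRsum : ∀ T : ℂ, ‖T‖ < r →
      HasSum (fun n : ℕ => ((PowerSeries.coeff n R : ℤ) : ℂ) * T ^ n) (Pc.eval T) := by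
    intro T hT
    by_cases hT0 : T = 0
    · subst hT0
      have hs := hasSum_single (f := fun n : ℕ => ((PowerSeries.coeff n R : ℤ) : ℂ) * (0 : ℂ) ^ n)
        0 (fun n hn => by rw [zero_pow hn, mul_zero])
      convert hs using 1
      rw [pow_zero, mul_one, hR0, ← coeff_zero_eq_eval_zero, hP0]
      simp
    · obtain ⟨s, hs⟩ := exists_card_cpow_neg_eq Fq hT0
      have hres : (2 : ℝ) < s.re := lt_re_of_card_cpow_neg_eq Fq hs (by rwa [hr] at hT)
      have h32 : (3 / 2 : ℝ) < s.re := by linarith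
      have h2 : (3 / 2 : ℝ) < 2 := by norm_num
      have hT' : ‖T‖ < (Fintype.card Fq : ℝ) ^ (-(2 : ℝ)) := by rwa [hr] at hT
      have hprod := hasSum_coeff_coe_mul (P := Q) (hasSum_coeff_formalL Fq W h2 hT')
        (summable_norm_coeff_formalL_mul_pow Fq W h2 hT')
      subst hs
      rw [← ellLFunction_eq_inv_analyticLInv Fq W h32, h s h32] at hprod
      exact hprod
  -- compare with `Pc`'s own (finite) expansion
  have hcoeff : (fun n : ℕ => ((PowerSeries.coeff n R : ℤ) : ℂ)) = fun n => Pc.coeff n :=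
    eq_of_forall_hasSum hr0 hRsum (fun T _ => hasSum_coeff_mul_pow_eval Pc T)
  refine ⟨PowerSeries.trunc (Pc.natDegree + 1) R, ?_, ?_⟩
  · ext n
    rw [Polynomial.coeff_map, PowerSeries.coeff_trunc]
    split_ifs with hn
    · rw [eq_intCast]
      exact congrFun hcoeff n
    · rw [map_zero, coeff_eq_zero_of_natDegree_lt (by omega)]
  · ext n
    rw [Polynomial.coeff_coe, PowerSeries.coeff_trunc]
    split_ifs with hn
    · rfl
    · have h1 : ((PowerSeries.coeff n R : ℤ) : ℂ) = Pc.coeff n := congrFun hcoeff n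
      rw [coeff_eq_zero_of_natDegree_lt (by omega)] at h1
      exact_mod_cast h1

end FunctionField

/-! ## The two cases at the exact constant field -/

section Cases

variable (Fq : Type) [Field Fq] [Fintype Fq] {F : Type} [Field F] [Algebra Fq[X] F]
  [Algebra (RatFunc Fq) F] [IsScalarTower Fq[X] (RatFunc Fq) F] [FunctionField Fq F]
variable (k : Type) [Field k] [Fintype k] [Algebra k[X] F] [Algebra (RatFunc k) F]
  [IsScalarTower k[X] (RatFunc k) F] [FunctionField k F]
variable (W : WeierstrassCurve F)

/-- **Non-constant `E`: `L(E, T)` is a polynomial, from Theorem 9.3.** Let `F` carry two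
global-function-field structures, over `𝔽_q` and over a finite field `k` which is the *full*
constant field of `F`, and let `W` be elliptic and non-constant over `k`. Ulmer's Theorem 9.3 at `k`
(`ellLFunction_eq_prod_of_not_isConstantCurve k W`: `L(E, s) = ∏ᵢ (1 - αᵢ q'^{-s})` on
`Re s > 3/2`, `q' = #k`) implies that the formal `L`-series over `𝔽_q` is a polynomial:
`formalL Fq W = P ∈ ℤ[T]` with `P(0) = 1` (indeed `P = ∏ᵢ (1 - αᵢ T^m)` over `ℂ`, `q' = q^m`).
Relies on: hypothesis `h93` (named fact, Grothendieck–Deligne; étale cohomology) and `hg`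
(the genus datum Theorem 9.3 mentions, from Weil's theorem for `F/k`).
[cite: Ulmer2011ParkCity, Lect. 1, §9, Thm. 9.3] -/
theorem formalL_eq_polynomial_of_not_isConstantCurve [W.IsElliptic] (hk : IsFullConstantField k F)
    {g : ℕ} (hg : IsGenus k F g) (hW : ¬ IsConstantCurve k W)
    (h93 : ellLFunction_eq_prod_of_not_isConstantCurve k W) :
    ∃ P : ℤ[X], P.coeff 0 = 1 ∧ formalL Fq W = P := by
  obtain ⟨N, α, -, -, -, -, -, hL⟩ := h93 g hk hg hW
  obtain ⟨ι, -⟩ := exists_ringHom_comp_eq_of_isFullConstantField Fq k hk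
    ((algebraMap Fq[X] F).comp Polynomial.C)
  obtain ⟨m, hm0, hm⟩ := exists_card_eq_pow_of_ringHom ι
  have hq0 : Fintype.card Fq ≠ 0 := Fintype.card_ne_zero
  -- the complex polynomial `∏ᵢ (1 - αᵢ T^m)`
  set Pc : ℂ[X] := ∏ i, (1 - C (α i) * X ^ m) with hPc
  have hPc_eval : ∀ T : ℂ, Pc.eval T = ∏ i, (1 - α i * T ^ m) := fun T => by
    rw [hPc, eval_prod]; simp
  have hPc0 : Pc.coeff 0 = 1 := by
    rw [coeff_zero_eq_eval_zero, hPc_eval, zero_pow hm0.ne']; simp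
  obtain ⟨P, hPmap, hP⟩ := exists_coe_mul_formalL_eq_of_ellLFunction_eq Fq W (Q := 1)
    (by simp) hPc0 (fun s hs => by
      rw [map_one, one_mul, hL s hs, hPc_eval, hm, natCast_pow_cpow_neg _ _ hq0])
  refine ⟨P, ?_, by rw [← hP, Polynomial.coe_one, one_mul]⟩
  have h1 := congrArg (fun p : ℂ[X] => p.coeff 0) hPmap
  simp only [coeff_map, eq_intCast, hPc0] at h1
  exact_mod_cast h1

/-- **Constant `E ≅ E₀ ×_k F`: `Q · L(E, T) = P` with the poles on the two circles, from
Exercise 9.2.** Let `F` carry two global-function-field structures, over `𝔽_q` and over a finite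
field `k` which is the full constant field of `F` (`#k = q' = q^m`), with Weil genus datum
`IsGenus k F g` (the `βⱼ`, `|βⱼ| = √q'`), and let `e • W = W₀ ⊗_k F` for an admissible change of
variables `e`. Then for the formal `L`-series over `𝔽_q` there are `P, Q ∈ ℤ[T]`, `Q(0) = 1`, all
complex roots of `Q` on `|z| = q^{-1/2}` or `|z| = q^{-3/2}`, with `Q · formalL Fq W = P`: namely
`Q = Q₀(T^m)` for the printed denominator `Q₀ = ∏ᵢ (1 - αᵢ u)(1 - αᵢ q' u) =
(1 - au + q'u²)(1 - q'au + q'³u²)` (`α₁ + α₂ = a = q' + 1 - #E₀(k)`, `α₁α₂ = q'`, `|αᵢ| = √q'` by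
Hasse–Weil, discharged in the tree as `WeierstrassCurve.card_point_baseChange_eq_holds`), and
`P = ∏_{i,j} (1 - αᵢβⱼ T^m)` over `ℂ`; the identity on `Re s > 3/2` is Ulmer's Exercise 9.2,
discharged in the tree (`ellLFunction_eq_div_of_isConstantCurve_holds`), transported to `ℤ[[T]]` by
`exists_coe_mul_formalL_eq_of_ellLFunction_eq`. Relies on: `hg` only (Weil's theorem for `F/k`).
[cite: Ulmer2011ParkCity, Lect. 1, §9, Exercise 9.2] -/
theorem exists_coe_mul_formalL_eq_of_smul_eq_map [W.IsElliptic] (hk : IsFullConstantField k F)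
    {g : ℕ} (hg : IsGenus k F g) {W₀ : WeierstrassCurve k} {e : WeierstrassCurve.VariableChange F}
    (he : e • W = W₀.map ((algebraMap k[X] F).comp Polynomial.C)) :
    ∃ P Q : ℤ[X], Q.coeff 0 = 1 ∧
      (∀ z ∈ (Q.map (Int.castRingHom ℂ)).roots,
        ‖z‖ = (Fintype.card Fq : ℝ) ^ (-(1 / 2 : ℝ)) ∨
          ‖z‖ = (Fintype.card Fq : ℝ) ^ (-(3 / 2 : ℝ))) ∧
      (Q : PowerSeries ℤ) * formalL Fq W = P := by
  haveI : W₀.IsElliptic := isElliptic_of_smul_eq_map he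
  obtain ⟨α, β, hsum, hprod, hα, hβ, hcount⟩ :=
    WeierstrassCurve.card_point_baseChange_eq.exists_roots W₀
      (WeierstrassCurve.card_point_baseChange_eq_holds W₀)
  obtain ⟨γ, hγ, hN⟩ := hg
  obtain ⟨ι, -⟩ := exists_ringHom_comp_eq_of_isFullConstantField Fq k hk
    ((algebraMap Fq[X] F).comp Polynomial.C)
  obtain ⟨m, hm0, hm⟩ := exists_card_eq_pow_of_ringHom ι
  have hq0 : Fintype.card Fq ≠ 0 := Fintype.card_ne_zero
  have hq'0 : Fintype.card k ≠ 0 := Fintype.card_ne_zero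
  have hq'pos : 0 < Fintype.card k := Fintype.card_pos
  -- Exercise 9.2 (discharged in the tree) with the Frobenius roots of `E₀` and the `βⱼ` of `ζ_F`
  set αv : Fin 2 → ℂ := ![α, β] with hαv
  have hαnorm : ∀ i, ‖αv i‖ = √(Fintype.card k : ℝ) := by
    intro i; fin_cases i <;> simp [hαv, hα, hβ]
  have hL := ellLFunction_eq_div_of_isConstantCurve_holds k W₀ W g αv γ hk ⟨e, he⟩
    (fun K _ _ _ => by rw [hcount K, Fin.sum_univ_two]; simp [hαv]; ring)
    (by simpa [hαv] using hprod) hαnorm hN hγ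
  -- the integer denominator `Q₀(T^m)` and the complex numerator `∏ (1 - αᵢ βⱼ T^m)`
  set a : ℤ := (Fintype.card k : ℤ) + 1 - (Nat.card W₀.toAffine.Point : ℤ) with ha
  set Q₀ : ℤ[X] := (1 - C a * X + C (Fintype.card k : ℤ) * X ^ 2) *
    (1 - C ((Fintype.card k : ℤ) * a) * X + C ((Fintype.card k : ℤ) ^ 3) * X ^ 2) with hQ₀
  set Pc : ℂ[X] := ∏ i, ∏ j, (1 - C (αv i * γ j) * X ^ m) with hPc
  have hPc_eval : ∀ T : ℂ, Pc.eval T = ∏ i, ∏ j, (1 - αv i * γ j * T ^ m) := fun T => by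
    rw [hPc, eval_prod]; simp [eval_prod]
  have hPc0 : Pc.coeff 0 = 1 := by
    rw [coeff_zero_eq_eval_zero, hPc_eval, zero_pow hm0.ne']; simp
  have hQ0 : (expand ℤ m Q₀).coeff 0 = 1 := by
    rw [coeff_expand hm0, if_pos (dvd_zero m), Nat.zero_div, hQ₀, coeff_zero_denominator]
  -- `u = q'^{-s} = (q^{-s})^m`
  have hu : ∀ s : ℂ, (Fintype.card k : ℂ) ^ (-s) = ((Fintype.card Fq : ℂ) ^ (-s)) ^ m :=
    fun s => by rw [hm, natCast_pow_cpow_neg _ _ hq0]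
  have hid : ∀ s : ℂ, (3 / 2 : ℝ) < s.re →
      aeval ((Fintype.card Fq : ℂ) ^ (-s)) (expand ℤ m Q₀) * ellLFunction W s =
        Pc.eval ((Fintype.card Fq : ℂ) ^ (-s)) := by
    intro s hs
    have hden : aeval ((Fintype.card Fq : ℂ) ^ (-s)) (expand ℤ m Q₀) =
        (∏ i, (1 - αv i * (Fintype.card k : ℂ) ^ (-s))) *
          ∏ i, (1 - αv i * (Fintype.card k : ℂ) ^ (1 - s)) := by
      rw [expand_aeval, ← hu s, hQ₀, aeval_denominator_eq hsum hprod, natCast_cpow_one_sub hq'0,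
        Fin.prod_univ_two, Fin.prod_univ_two]
      simp [hαv]
    have hD : (∏ i, (1 - αv i * (Fintype.card k : ℂ) ^ (-s))) *
        ∏ i, (1 - αv i * (Fintype.card k : ℂ) ^ (1 - s)) ≠ 0 := by
      refine mul_ne_zero (Finset.prod_ne_zero_iff.mpr fun i _ => ?_)
        (Finset.prod_ne_zero_iff.mpr fun i _ => ?_)
      · exact (one_sub_mul_card_cpow_ne_zero k (hαnorm i) hs).1
      · rw [natCast_cpow_one_sub hq'0]
        exact (one_sub_mul_card_cpow_ne_zero k (hαnorm i) hs).2
    rw [hL s hs, ← mul_div_assoc, hden, mul_div_cancel_left₀ _ hD, hPc_eval, ← hu s]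
  obtain ⟨P, -, hP⟩ := exists_coe_mul_formalL_eq_of_ellLFunction_eq Fq W hQ0 hPc0 hid
  refine ⟨P, expand ℤ m Q₀, hQ0, fun z hz => ?_, hP⟩
  -- `z^m` is a root of `Q₀`, hence `|z|^m = q'^{-1/2}` or `q'^{-3/2}`
  rw [map_expand, mem_roots', IsRoot.def, expand_eval, eval_map, ← algebraMap_int_eq,
    ← aeval_def] at hz
  have hw := norm_eq_rpow_of_aeval_denominator_eq_zero hq'pos hsum hprod hα hβ hz.2
  rw [norm_pow] at hw
  have hqR : (0 : ℝ) ≤ Fintype.card Fq := Nat.cast_nonneg _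
  have hcast : ((Fintype.card k : ℝ)) = (Fintype.card Fq : ℝ) ^ m := by rw [hm]; push_cast; rfl
  rcases hw with hw | hw
  · exact Or.inl (norm_eq_rpow_of_norm_pow_eq hm0.ne' hqR (by rw [hw, hcast]))
  · exact Or.inr (norm_eq_rpow_of_norm_pow_eq hm0.ne' hqR (by rw [hw, hcast]))

/-- **`isRational_formalL Fq W` from the leaves, at the exact constant field.** Let `F` carry two
global-function-field structures, over `𝔽_q` and over its full constant field `k`. Weil's theorem
for `F/k` (`existsUnique_isGenus k F`: the genus datum `βⱼ`) and Ulmer's Theorem 9.3 for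
non-constant `E` (`ellLFunction_eq_prod_of_not_isConstantCurve k W`) imply Grothendieck rationality
of the formal `L`-series `formalL Fq W` with the printed location of its poles — by the dichotomy
constant / non-constant over `k` (Ulmer (2011), Lecture 1, §9: Exercise 9.2 / Theorem 9.3), the
constant case being unconditional up to `hWeil` (`exists_coe_mul_formalL_eq_of_smul_eq_map`) and
the non-constant case giving `Q = 1` (`formalL_eq_polynomial_of_not_isConstantCurve`).
Relies on: hypotheses `hWeil`, `h93` (named facts). [cite: Ulmer2011ParkCity, Lect. 1, §9,
Exercise 9.2 and Thm. 9.3] -/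
theorem isRational_formalL_of_isFullConstantField_of_facts (hk : IsFullConstantField k F)
    (hWeil : existsUnique_isGenus k F) (h93 : ellLFunction_eq_prod_of_not_isConstantCurve k W) :
    isRational_formalL Fq W := by
  intro hE
  obtain ⟨g, hg, -⟩ := hWeil hk
  by_cases hc : IsConstantCurve k W
  · obtain ⟨W₀, e, he⟩ := hc
    exact exists_coe_mul_formalL_eq_of_smul_eq_map Fq k W hk hg he
  · obtain ⟨P, -, hP⟩ := formalL_eq_polynomial_of_not_isConstantCurve Fq k W hk hg hc h93
    refine ⟨P, 1, by simp, fun z hz => ?_, by rw [Polynomial.coe_one, one_mul, hP]⟩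
    simp at hz

end Cases

/-! ## Assembly over every constant field -/

section Assembly

variable (Fq : Type) [Field Fq] [Fintype Fq] {F : Type} [Field F] [Algebra Fq[X] F]
  [Algebra (RatFunc Fq) F] [IsScalarTower Fq[X] (RatFunc Fq) F] [FunctionField Fq F]
  (W : WeierstrassCurve F)

/-- **`isRational_formalL` from two leaves, for every constant field.** For an arbitrary
global-function-field structure `F / 𝔽_q(t)` (the constant field `𝔽_q` need not be exact) and every
Weierstrass curve `W / F`, the named fact `isRational_formalL Fq W` of `FunctionFieldEllipticLFormal`
(for elliptic `W`: `Q · L(E, T) = P` in `ℤ[[T]]`, `Q(0) = 1`, poles on `|T| = q^{-1/2}, q^{-3/2}`)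
holds, granted over the finite constant fields `k` of `F`: Weil's theorem for `F/k`
(`existsUnique_isGenus k F`) and Ulmer's Theorem 9.3 for non-constant `E`
(`ellLFunction_eq_prod_of_not_isConstantCurve k W`, Grothendieck–Deligne). Proof: pass to the
exact constant field (`exists_functionField_isFullConstantField`) and apply
`isRational_formalL_of_isFullConstantField_of_facts`. Exercise 9.2 and Hasse–Weil for `E₀` are
theorems of the tree and do not appear. Relies on: hypotheses `hWeil`, `h93` (named facts; `h93`
is the deep leaf). [cite: Ulmer2011ParkCity, Lect. 1, §9, Exercise 9.2 and Thm. 9.3] -/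
theorem isRational_formalL_of_facts₂
    (hWeil : ∀ (k : Type) [Field k] [Fintype k] [Algebra k[X] F] [Algebra (RatFunc k) F]
      [IsScalarTower k[X] (RatFunc k) F] [FunctionField k F], existsUnique_isGenus k F)
    (h93 : ∀ (k : Type) [Field k] [Fintype k] [Algebra k[X] F] [Algebra (RatFunc k) F]
      [IsScalarTower k[X] (RatFunc k) F] [FunctionField k F],
      ellLFunction_eq_prod_of_not_isConstantCurve k W) :
    isRational_formalL Fq W := by
  intro hE
  obtain ⟨k, _, _, _, _, _, hFF, hfull⟩ := exists_functionField_isFullConstantField Fq F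
  haveI := hFF
  exact isRational_formalL_of_isFullConstantField_of_facts Fq k W hfull (hWeil k) (h93 k)

/-- **The two leaves in corrected form.** The same, with Weil's theorem for `F` in its corrected
vendored form `existsUnique_isGenus_of_functionField k F` (`FunctionFieldPlacesGenusProofs`; the
same `Prop` as `existsUnique_isGenus k F` at a global function field,
`existsUnique_isGenus_of_functionField_iff`). This is the assembled form of the provefact target
`isRational_formalL Fq W`: what remains open in the tree are the leaves `h93` (étale cohomology)
and `hWeil` (the Riemann hypothesis for curves over finite fields, itself reduced to Stichtenoth
Thm. 5.1.15 (a) and Thm. 5.2.1 in `FunctionFieldZetaProofs`). Relies on: hypotheses `hWeil`, `h93`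
(named facts). [cite: Ulmer2011ParkCity, Lect. 1, §9, Exercise 9.2 and Thm. 9.3] -/
theorem isRational_formalL_of_leaves
    (hWeil : ∀ (k : Type) [Field k] [Fintype k] [Algebra k[X] F] [Algebra (RatFunc k) F]
      [IsScalarTower k[X] (RatFunc k) F] [FunctionField k F],
      existsUnique_isGenus_of_functionField k F)
    (h93 : ∀ (k : Type) [Field k] [Fintype k] [Algebra k[X] F] [Algebra (RatFunc k) F]
      [IsScalarTower k[X] (RatFunc k) F] [FunctionField k F],
      ellLFunction_eq_prod_of_not_isConstantCurve k W) :
    isRational_formalL Fq W :=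
  isRational_formalL_of_facts₂ Fq W
    (fun k _ _ _ _ _ _ => (existsUnique_isGenus_of_functionField_iff k F).mp (hWeil k)) h93

/-- **From three textbook leaves.** `isRational_formalL Fq W` granted, over every finite constant
field `k` of `F` with a compatible `k`-algebra structure, Stichtenoth Thm. 5.1.15 (a)
(`lSeries_eq_polynomial k F`: `L(t) = (1 - t)(1 - qt)Z(t) ∈ ℤ[t]` of degree `2g`) and Thm. 5.2.1
(`hasseWeil k F`, the Riemann hypothesis for `F/k`), and Ulmer's Theorem 9.3 (`h93`). The genus
leaf is supplied by `existsUnique_isGenus_of_functionField_of_zeta_facts` at the algebra structure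
`k → k[X] → F`. Relies on: hypotheses `hL`, `hHW`, `h93` (named facts, open in the tree).
[cite: Ulmer2011ParkCity, Lect. 1, §9, Exercise 9.2 and Thm. 9.3]
[cite: Stichtenoth2009, Thm. 5.1.15(a) and Thm. 5.2.1] -/
theorem isRational_formalL_of_zeta_leaves
    (hL : ∀ (k : Type) [Field k] [Fintype k] [Algebra k[X] F] [Algebra (RatFunc k) F]
      [IsScalarTower k[X] (RatFunc k) F] [FunctionField k F] [Algebra k F] [IsScalarTower k k[X] F],
      DiophantineGeometry.AlgFunctionField.lSeries_eq_polynomial k F)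
    (hHW : ∀ (k : Type) [Field k] [Fintype k] [Algebra k[X] F] [Algebra (RatFunc k) F]
      [IsScalarTower k[X] (RatFunc k) F] [FunctionField k F] [Algebra k F] [IsScalarTower k k[X] F],
      DiophantineGeometry.AlgFunctionField.hasseWeil k F)
    (h93 : ∀ (k : Type) [Field k] [Fintype k] [Algebra k[X] F] [Algebra (RatFunc k) F]
      [IsScalarTower k[X] (RatFunc k) F] [FunctionField k F],
      ellLFunction_eq_prod_of_not_isConstantCurve k W) :
    isRational_formalL Fq W := by
  refine isRational_formalL_of_leaves Fq W (fun k _ _ _ _ _ _ => ?_) h93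
  letI : Algebra k F := ((algebraMap k[X] F).comp Polynomial.C).toAlgebra
  haveI : IsScalarTower k k[X] F := IsScalarTower.of_algebraMap_eq fun c => by
    rw [RingHom.algebraMap_toAlgebra, RingHom.comp_apply, Polynomial.C_eq_algebraMap]
  exact existsUnique_isGenus_of_functionField_of_zeta_facts k F (hL k) (hHW k)

/-- **From F. K. Schmidt's theorem, the Hasse–Weil theorem and Ulmer's Theorem 9.3.**
`isRational_formalL Fq W` granted, over every finite constant field `k` of `F` with a compatible
`k`-algebra structure for which `k` is the full constant field, the existence of a divisor of
degree one (`minPosDegree k F = 1`, Stichtenoth Cor. 5.1.11 — F. K. Schmidt 1931) and the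
Hasse–Weil theorem (`hasseWeil k F`, Thm. 5.2.1); and Ulmer's Theorem 9.3 (`h93`). Thm. 5.1.15 (a)
is supplied by `lSeries_eq_polynomial_of_minPosDegree_eq_one` (`FunctionFieldZetaRationalityProofs`:
Riemann–Roch and Lemma 5.1.4, proved in the tree). Relies on: hypotheses `hd`, `hHW`, `h93` (open
in the tree: constant field extensions, Bombieri–Stepanov, Grothendieck–Deligne respectively).
[cite: Ulmer2011ParkCity, Lect. 1, §9, Exercise 9.2 and Thm. 9.3]
[cite: Stichtenoth2009, Cor. 5.1.11 and Thm. 5.2.1] -/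
theorem isRational_formalL_of_schmidt_leaves
    (hd : ∀ (k : Type) [Field k] [Fintype k] [Algebra k[X] F] [Algebra (RatFunc k) F]
      [IsScalarTower k[X] (RatFunc k) F] [FunctionField k F] [Algebra k F] [IsScalarTower k k[X] F]
      [DiophantineGeometry.IsAlgFunctionField k F] [IsIntegrallyClosedIn k F],
      DiophantineGeometry.AlgFunctionField.minPosDegree k F = 1)
    (hHW : ∀ (k : Type) [Field k] [Fintype k] [Algebra k[X] F] [Algebra (RatFunc k) F]
      [IsScalarTower k[X] (RatFunc k) F] [FunctionField k F] [Algebra k F] [IsScalarTower k k[X] F],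
      DiophantineGeometry.AlgFunctionField.hasseWeil k F)
    (h93 : ∀ (k : Type) [Field k] [Fintype k] [Algebra k[X] F] [Algebra (RatFunc k) F]
      [IsScalarTower k[X] (RatFunc k) F] [FunctionField k F],
      ellLFunction_eq_prod_of_not_isConstantCurve k W) :
    isRational_formalL Fq W := by
  refine isRational_formalL_of_zeta_leaves Fq W (fun k _ _ _ _ _ _ _ _ => ?_) hHW h93
  intro _ _
  exact DiophantineGeometry.AlgFunctionField.lSeries_eq_polynomial_of_minPosDegree_eq_one (hd k)

end Assembly

end Literature.NumberTheory.EllipticCurves.FunctionField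

end
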